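import Literature.NumberTheory.EllipticCurves.SerreOpenImageNormalizerCaseProofs
import Literature.NumberTheory.GaloisRepresentations.TransvectionCriterionGL2FpProofs
import HarnessLib

/-!
# No "σ-type" element at a prime of irreducible, non-surjective mod-`p` image (`E/ℚ`)

Topic `NumberTheory/EllipticCurves`; theorems only (nothing is defined, no named fact).  For an
elliptic curve `E = W/ℚ` and a prime `p` write `ρ̄ = ρ̄_{E,p} : Γ_ℚ → Aut(E[p])`
(`galoisRepTorsion W p`, `GaloisAction`).  The Euler-system and Kolyvagin-system arguments behind the
`p`-part of the Birch–Swinnerton-Dyer formula in analytic rank `≤ 1` at a good ordinary prime —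
Kato, *Astérisque* 295 (2004), Thm. 17.4 (3) via (12.5.2) / Thm. 13.4 (3); Skinner, Pacific J.
Math. 283 (2016), §2.5 (b); Burungale–Castella–Skinner, IMRN 2025, Thm. 1.1.2 (b) and Cor. 1.3.1
under (im): "there exists an element `σ ∈ G_{ℚ(μ_{p^∞})}` such that `T/(σ - 1)T ≃ ℤ_p`"
(`T = T_pE`) — need a Galois element `σ` acting trivially on the `p`-power roots of unity whose
`σ - 1` has cyclic cokernel of rank one on the Tate module.  Reducing modulo `p` (`T/pT = E[p]`,
right exactness of `⊗ 𝔽_p`), such a `σ` has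

  `χ̄_p(σ) = 1`  and  `#(E[p]/(σ - 1)E[p]) = p`.                                          (im̄)

**Theorem** (`WeierstrassCurve.natCard_quotient_range_sub_id_ne`).  If `E[p]` is irreducible
and `ρ̄_{E,p}` is NOT surjective, then NO `σ ∈ Γ_ℚ` satisfies (im̄).  In particular hypothesis (im)
fails identically on the "residually small but irreducible" images (normaliser of a split or
non-split Cartan subgroup, projective image `𝔖₄` — and `𝔄₄`, `𝔄₅`, which do not occur over `ℚ`):
it is not a hypothesis of convenience there but is violated by every Galois element.

Proof (Serre 1972, §2.4 Prop. 15 read backwards; the group theory is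
`TransvectionCriterionGL2FpProofs`): in a frame `E[p] ≅ 𝔽_p²` (`exists_frame_galoisRepTorsion_rat`)
the image `G = ρ̄(Γ_ℚ) ≤ GL₂(𝔽_p)` has `det G = 𝔽_pˣ` (Weil pairing: `det ρ̄ = χ̄_p`, onto over
`ℚ`), lies in no Borel subgroup (`E[p]` irreducible) and is proper (`ρ̄` not onto); `g = ρ̄(σ)` has
`det g = χ̄_p(σ) = 1`, and `#(σ - 1)E[p] = p` makes `g - 1` non-zero and singular; so `g` is a
transvection of order `p`, `p ∣ #G`, and Prop. 15 forces `G ⊇ SL₂(𝔽_p)` (so `G = GL₂(𝔽_p)`) or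
`G` Borel — contradiction.  Equivalently (Burungale–Castella–Skinner, Rem. 1.1.3 (iii); the
literature seat's remark F1 of the BSD rank-≤1 residual census): for `E[p]` irreducible,
(im) ⟹ `ρ̄_{E,p}` surjective.

* `WeierstrassCurve.modPCyclotomicCharacterZMod_eq_one_of_forall_smul_eq` — `σ` fixes `μ_p` ⟹
  `χ̄_p(σ) = 1`.
* `WeierstrassCurve.natCard_quotient_range_sub_id_ne` — the theorem, hypothesis `χ̄_p(σ) = 1`.
* `WeierstrassCurve.natCard_quotient_range_sub_id_ne_of_forall_smul_eq` — the same with the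
  literal hypothesis "`σ ∈ G_{ℚ(μ_{p^∞})}`" (`σ` fixes every `p`-power root of unity in `ℚ̄`).

What is NOT here: the `ℤ_p`-level statement about `T_pE` itself (it follows from this file and
`T_pE/pT_pE ≅ E[p]`; the mod-`p` shadow is what the group theory sees), and anything about the
reducible case (there transvections abound: `E[p]` reducible is Serre's Borel case).

## References

* [Serre1972] J.-P. Serre, Invent. Math. 15 (1972) 259–331, §2.4 Prop. 15, §2.6, §5.2 (iii),
  §5.4 (proof of Prop. 21 i)).
* [Kato2004] K. Kato, Astérisque 295 (2004), Thm. 13.4 (3), (12.5.2), Thm. 17.4 (3).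
* [Skinner2016PacificMC] C. Skinner, Pacific J. Math. 283 (2016) 171–200, §2.5 (a), (b).
* [BurungaleCastellaSkinner2025] A. Burungale, F. Castella, C. Skinner, IMRN 2025 (rnaf082) =
  arXiv:2405.00270v2, (irr_ℚ), (im), (sur), Thm. 1.1.2, Rem. 1.1.3 (iii), Cor. 1.3.1.
-/

noncomputable section

open scoped Classical
open Matrix Field

namespace WeierstrassCurve

open Literature.NumberTheory.EllipticCurves Literature.NumberTheory.GaloisRepresentations
  Literature.NumberTheory.GaloisRepresentations.Serre1972

variable (W : WeierstrassCurve ℚ) [W.IsElliptic] (p : ℕ) [Fact p.Prime]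

/-- **`σ` fixes `μ_p` ⟹ `χ̄_p(σ) = 1`**: an element of `Γ_ℚ` acting trivially on every `p`-th
root of unity of `ℚ̄` has trivial mod-`p` cyclotomic character (uniqueness in Mathlib's
`modularCyclotomicCharacter.unique`). [folklore] -/
theorem modPCyclotomicCharacterZMod_eq_one_of_forall_smul_eq (σ : absoluteGaloisGroup ℚ)
    (hσ : ∀ t : AlgebraicClosure ℚ, t ^ p = 1 → σ • t = t) :
    modPCyclotomicCharacterZMod ℚ p σ = 1 := by
  ext
  refine (modularCyclotomicCharacter.unique (AlgebraicClosure ℚ)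
    (HasEnoughRootsOfUnity.natCard_rootsOfUnity (AlgebraicClosure ℚ) p) _ fun t ht => ?_).symm
  rw [Units.val_one, ZMod.val_one, pow_one]
  have ht' : ((t : (AlgebraicClosure ℚ)ˣ) : AlgebraicClosure ℚ) ^ p = 1 := by
    rw [← Units.val_pow_eq_pow_val, (mem_rootsOfUnity p t).mp ht, Units.val_one]
  exact hσ (t : AlgebraicClosure ℚ) ht'

omit [W.IsElliptic] in
/-- Transport of `σ̄ - 1` through a frame: `e ((ρ̄(σ) - 1) x) = (Φ(ρ̄ σ) - 1) · e x`. [folklore] -/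
theorem frame_apply_sub_id_apply
    (Φ : Multiplicative (AddAut (geomTorsion W p)) ≃* GL (Fin 2) (ZMod p))
    (e : geomTorsion W p ≃+ (Fin 2 → ZMod p))
    (he : ∀ (g : Multiplicative (AddAut (geomTorsion W p))) (x : geomTorsion W p),
      e (Multiplicative.toAdd g x) =
        ((Φ g : GL (Fin 2) (ZMod p)) : Matrix (Fin 2) (Fin 2) (ZMod p)) *ᵥ e x)
    (σ : absoluteGaloisGroup ℚ) (x : geomTorsion W p) :
    e (((Multiplicative.toAdd (galoisRepTorsion W p σ)).toAddMonoidHom -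
        AddMonoidHom.id (geomTorsion W p)) x) =
      (((Φ (galoisRepTorsion W p σ) : GL (Fin 2) (ZMod p)) : Matrix (Fin 2) (Fin 2) (ZMod p)) - 1)
        *ᵥ e x := by
  rw [AddMonoidHom.sub_apply, AddMonoidHom.id_apply, AddEquiv.coe_toAddMonoidHom, map_sub, he,
    Matrix.sub_mulVec, Matrix.one_mulVec]

/-- **No σ-type Galois element at an irreducible, non-surjective prime.**  Let `E = W/ℚ` be an
elliptic curve and `p` a prime with `E[p]` irreducible and `ρ̄_{E,p}` not surjective.  Then for
every `σ ∈ Γ_ℚ` with `χ̄_p(σ) = 1` the cokernel `E[p]/(σ - 1)E[p]` does NOT have exactly `p`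
elements; i.e. the mod-`p` shadow (im̄) of hypothesis (im) of Burungale–Castella–Skinner 2025 /
Kato 2004 Thm. 13.4 (3) / Skinner 2016 §2.5 (b) fails for every Galois element.  (Serre's Prop. 15
read backwards: such a `σ` would act on `E[p]` by a transvection of order `p`, forcing the proper,
non-Borel image with full determinant to contain `SL₂(𝔽_p)`.)
[cite: Serre1972, §2.4 Prop. 15 and §5.4 (proof of Prop. 21 i))] -/
theorem natCard_quotient_range_sub_id_ne (hirr : W.HasIrreducibleModPGaloisRep p)
    (hns : ¬ W.HasSurjectiveModNGaloisRep p) (σ : absoluteGaloisGroup ℚ)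
    (hχ : modPCyclotomicCharacterZMod ℚ p σ = 1) :
    Nat.card (geomTorsion W p ⧸
      ((Multiplicative.toAdd (galoisRepTorsion W p σ)).toAddMonoidHom -
        AddMonoidHom.id (geomTorsion W p)).range) ≠ p := by
  have hp : p.Prime := Fact.out
  intro hcard
  obtain ⟨e, Φ, he, -, hdetχ, -, -⟩ := exists_frame_galoisRepTorsion_rat W p
  set G : Subgroup (GL (Fin 2) (ZMod p)) := (galoisRepTorsion W p).range.map Φ.toMonoidHom
    with hG
  set g : GL (Fin 2) (ZMod p) := Φ (galoisRepTorsion W p σ) with hg_def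
  set f : geomTorsion W p →+ geomTorsion W p :=
    (Multiplicative.toAdd (galoisRepTorsion W p σ)).toAddMonoidHom -
      AddMonoidHom.id (geomTorsion W p) with hf
  have hg : g ∈ G := apply_galoisRepTorsion_mem_map_range W p Φ σ
  have hdet1 : Matrix.GeneralLinearGroup.det g = 1 := by rw [hg_def, hdetχ σ, hχ]
  -- `#E[p] = p²`, so `#(σ - 1)E[p] = p` by Lagrange
  have hp' : (p : AlgebraicClosure ℚ) ≠ 0 := Nat.cast_ne_zero.mpr hp.ne_zero
  have hE : Nat.card (geomTorsion W p) = p ^ 2 :=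
    card_torsionPoints_eq_sq_holds W (AlgebraicClosure ℚ) (n := p) hp'
  have hrange : Nat.card f.range = p := by
    have hL := AddSubgroup.card_eq_card_quotient_mul_card_addSubgroup f.range
    rw [hE, hcard, sq] at hL
    exact (Nat.eq_of_mul_eq_mul_left hp.pos hL).symm
  -- transport to the matrix `g - 1`
  have hfe : ∀ x, e (f x) =
      (((g : GL (Fin 2) (ZMod p)) : Matrix (Fin 2) (Fin 2) (ZMod p)) - 1) *ᵥ e x :=
    fun x => frame_apply_sub_id_apply W p Φ e he σ x
  have hequiv : f.range ≃
      LinearMap.range (Matrix.mulVecLin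
        (((g : GL (Fin 2) (ZMod p)) : Matrix (Fin 2) (Fin 2) (ZMod p)) - 1)) :=
    e.toEquiv.subtypeEquiv fun a => by
      rw [AddMonoidHom.mem_range, LinearMap.mem_range]
      constructor
      · rintro ⟨x, rfl⟩
        exact ⟨e x, by rw [Matrix.mulVecLin_apply, ← hfe]; rfl⟩
      · rintro ⟨w, hw⟩
        refine ⟨e.symm w, e.injective ?_⟩
        rw [hfe, AddEquiv.apply_symm_apply, ← Matrix.mulVecLin_apply, hw]
        rfl
  have hrange' : Nat.card (LinearMap.range (Matrix.mulVecLin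
      (((g : GL (Fin 2) (ZMod p)) : Matrix (Fin 2) (Fin 2) (ZMod p)) - 1))) = p := by
    rw [← Nat.card_congr hequiv, hrange]
  obtain ⟨hne, hsing⟩ := ne_zero_and_det_eq_zero_of_natCard_range_mulVecLin hrange'
  have hg1 : g ≠ 1 := by
    intro h1
    apply hne
    rw [h1, Units.val_one, sub_self]
  -- the image is proper, has full determinant and no common eigenvector
  have hGtop : G ≠ ⊤ := fun h => hns ((map_range_galoisRepTorsion_eq_top_iff W p Φ).mp h)
  have hdetG : ∀ u : (ZMod p)ˣ, ∃ g ∈ G, Matrix.GeneralLinearGroup.det g = u :=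
    exists_mem_map_range_det_eq W p Φ e he
  have hirrG : ∀ (v : Fin 2 → ZMod p) (hv : v ≠ 0), ¬ G ≤ eigenvectorStabilizer v hv :=
    fun v hv => not_le_eigenvectorStabilizer_of_hasIrreducibleModPGaloisRep W p Φ e he hirr hv
  exact hg1 (eq_one_of_det_eq_one_of_det_sub_one_eq_zero G hdetG hGtop hirrG hg hdet1 hsing)

/-- **The same with the literal hypothesis `σ ∈ G_{ℚ(μ_{p^∞})}`** of Burungale–Castella–Skinner
(im) / Kato Thm. 13.4 (3): if `σ` fixes every `p`-power root of unity of `ℚ̄`, `E[p]` is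
irreducible and `ρ̄_{E,p}` is not surjective, then `#(E[p]/(σ - 1)E[p]) ≠ p` — so `T_pE/(σ-1)T_pE`
cannot be free of rank one over `ℤ_p` (its reduction mod `p` would be a line).
[cite: BurungaleCastellaSkinner2025, hypothesis (im) and Remark 1.1.3 (iii)] -/
theorem natCard_quotient_range_sub_id_ne_of_forall_smul_eq (hirr : W.HasIrreducibleModPGaloisRep p)
    (hns : ¬ W.HasSurjectiveModNGaloisRep p) (σ : absoluteGaloisGroup ℚ)
    (hσ : ∀ (n : ℕ) (t : AlgebraicClosure ℚ), t ^ p ^ n = 1 → σ • t = t) :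
    Nat.card (geomTorsion W p ⧸
      ((Multiplicative.toAdd (galoisRepTorsion W p σ)).toAddMonoidHom -
        AddMonoidHom.id (geomTorsion W p)).range) ≠ p :=
  natCard_quotient_range_sub_id_ne W p hirr hns σ
    (modPCyclotomicCharacterZMod_eq_one_of_forall_smul_eq p σ
      fun t ht => hσ 1 t (by rwa [pow_one]))

end WeierstrassCurve
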